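import Summits.HodgeConjecture.HodgeConjecture.Theorems.F0P6aStubDOWNSpecHeads
import Summits.HodgeConjecture.HodgeConjecture.Theorems.F0P6aStubRHO1
import HarnessLib

/-!
# `F0P6aStubDOWNOrgans` — ★ RE-HOME of `Lines/F0_P6a_StubDOWN.lean`, PART 5 of 7 (size-lint split; cut at a declaration boundary).

Imports: ★ `Theorems.F0P6aStubDOWNSpecHeads` = the previous part of the same Lines workfile `F0_P6a_StubDOWN` (size-lint split ×7) + `HarnessLib` (canonical header: bare `import` lines).
v3e (LEAD F0P6-plan (g7) «M-150f» (A), LA2-plan (g5) DEAL 12): + ★ `Theorems.F0P6aStubRHO1` as the 2nd import — MOVED here from PART 1 `Laws` (its only code reader in the chain is `stub_SPEC`՚s payment term `…F0P6aLineSpecialisation.exists_quotLegReduction` below); 0 statement∕proof bytes change.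
See PART 1 `Theorems/F0P6aStubDOWNLaws.lean` for the full re-home header and the original module docstring (verbatim there). Namespaces and sections KEPT
(re-opened below exactly as they stand at the cut, with their `open`∕`variable` lines replayed); code bytes = the workfile՚s, docstrings included; options preamble repeated from PART 1.
HC_CM is proved only modulo the 7 printed citations (2 remaining: hLiu418 = stmt-HodgeConjecture-24832, h413 = stmt-HodgeConjecture-24833) until rung 0 closes; a re-home is count-neutral. -/

set_option autoImplicit false
set_option linter.dupNamespace false

noncomputable section

namespace Summit.HodgeConjecture.HodgeConjecture.Cruxes.HLiu418.F0P6aStubDOWN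
open CategoryTheory CategoryTheory.Limits NumberField IsDedekindDomain MulAction
open scoped Matrix Polynomial Pointwise MonoidalCategory
open Literature.NumberTheory.GaloisRepresentations
open Literature.NumberTheory.Automorphic Literature.NumberTheory.Automorphic.UnitaryGroup
open Literature.AlgebraicGeometry.ShimuraVarieties.UnitaryCanonicalModel
open Literature.NumberTheory.Automorphic.Liu2021.AppendixC
open Literature.AlgebraicGeometry.Motives (AlgPoints IntegralModel SchemeOver thickening thickeningGalAction thickeningLift specOver relFrobeniusOver frobeniusTwistOver)
open Literature.NumberTheory.DiophantineGeometry (geomResidueField specialFibreFunctor specResidueField)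
open Literature.AlgebraicGeometry.RelativeSpec (ActionOver)
open Literature.NumberTheory.EllipticCurves (genericFibre)
open Literature.AlgebraicGeometry.GroupSchemes.AffineGroupScheme (Alg quotIncl)
open Summit.HodgeConjecture.HodgeConjecture.Cruxes.HLiu418.F0P6cDictConstructors (kerFI AdmSub IdealIsEtale isAdm_kerFI)
open Summit.HodgeConjecture.HodgeConjecture.Cruxes.HLiu418.F0P6aModuliDatumDefs
open Summit.HodgeConjecture.HodgeConjecture.Cruxes.HLiu418.F0P6aRGDAssembly
open Summit.HodgeConjecture.HodgeConjecture.Cruxes.HLiu418.F0P6aDatumOfInputs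
open Summit.HodgeConjecture.HodgeConjecture.Cruxes.HLiu418.F0P6aLineSpecialisation (spGeoOf canonicalLine_spGeoOf spGeoOf_surjective hrkG_of_dock
  exists_isogW₀_of_quotLeg mono_coverPin₀ le_ker_isogW₀_of_himg red₀Of_translΩ_eq_of_red₀Of_eq red₀Of_quotΩ_eq_red₀Of_translΩ_of_le_ker_layer
  red₀Of_quotΩ_eq_of_quotLegReduction₀)  -- [ED. 4] organ heads BY NAME (incl. the §Q head `red₀Of_quotΩ_eq_of_quotLegReduction₀`, PART B)


/-! ### §1 THE FOUR ORGANS AND THE HEAD -/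

section Stubs

-- the frame of the tree՚s `Stubs` section VERBATIM (incl. the auto-included instances `[IsGalois ℚ F] [FiniteDimensional F Fi] [IsGalois F Fi] [Finite G]`)
variable {F : Type} [Field F] [NumberField F] [IsCMField F] [IsGalois ℚ F] {ι₁ : F →+* ℂ}
    {Jstar : Matrix (Fin 2) (Fin 2) F}
    {K₀ : C5.OpenCompactSubgroup ↥(finAdelic ↥(maximalRealSubfield F) F (IsCMField.complexConj F) 2 Jstar)}
    {S : RecordSystemGS F Jstar ι₁ K₀} {hU7ₛ : S.HeckeTranslateDefinedOver}
    {hJ : (Jstar.map (IsCMField.complexConj F))ᵀ = Jstar} {hJu : IsUnit Jstar}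
    {Fi : Type} [Field Fi] [Algebra F Fi] [FiniteDimensional F Fi] [IsGalois F Fi] {Kc : C5.SmallLevel K₀} {G : Type} [Group G] [Finite G]
    {𝓜 : IntegralModel (𝓞 F) F ((thickening F Fi).obj (S.M.obj Kc))}
    {w : HeightOneSpectrum (𝓞 F)} {hw : (IsCMField.complexConj F) • w ≠ w} {h𝓨 : (𝓜.localise w).IsSmoothProper 1}
    {θ : ActionOver (𝓜.localise w).total.hom ((Fi ≃ₐ[F] Fi) × G)}
    {e : Fi →ₐ[F] AlgebraicClosure (w.adicCompletion F)}

set_option maxHeartbeats 400000 in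
omit [FiniteDimensional F Fi] [IsGalois F Fi] [Finite G] in -- [ED. 4] the paid body uses none of the three auto-included instances (linter.unusedSectionVars)
/-- **`stub_SPEC` — THE `e`-SHEET READINGS WITH THEIR LAWS** (O-K road): there are `sp` (D5: schematic closure of `H_L ⊕ H_L^⊥` over `𝒪_Ω̄`, read in `AdmSub (G₀ (red₀ y))` through
`hkerG₀` — organ (S-c) ★ p847642 + ★ `KernelIdealSpecialFibre` p847578∕p847604), `quot`∕`transl` (SP4 `red₀ ∘ quotΩ ∘ lift`, `red₀ ∘ translΩ ∘ lift`, well defined by (L1′) `I.inj₀` on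
the reduced roofs ★ (ν8) p847636, CONSTANT off the `e`-sheet) and `isogW₀` (the `c•w`-layer map of `d ∘ q`, ★ `IdealKernelLayerMap.exists_layerMap_of_isClosedImmersion`, TRIVIAL off
the `e`-sheet) with: (c2) `red_quotΩ`∕`red_translΩ`, (b4′) ★ `CanonicalLine.existsUnique_admK_spI_eq_kerFI`, SP-surjectivity ★ `exists_admissible_spI_eq_of_ordinary∕_of_supersingular`,
`IsogHomLaw` (★ `isMonHom_of_comp_eq`), `IsogKerLaw` ((O-K)(d) `quotIncl_spI_comp_eq_one`), and D6 `QuotQuot₀Law` by ROAD H: ★ HBT `exists_line_quotΩ_quotΩ_eq_translΩ_of_hecke_of_hyperspecial`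
(eats `_hhecke _hunit _hKc`) + (H4′) «backtracking line = image line» ((SP-img) + (D6-rk) rank recognition) + (H5) transfer by the red laws; off the sheet the three K-laws hold
for the constant∕trivial values tautologically.  Why it might fail: only through an orientation slip upstream (D4), then D6 is false on the `w`-block by an order count.
[cite: Liu2021, Prop. D.8 p. 135, pp. 136–138] [cite: Tate1997FiniteFlatGroupSchemes, (3.7)] [cite: Carayol1986Compositio, §10.3 Prop. p. 211] [cite: Kottwitz1992, §5, p. 391] -/
theorem stub_SPEC (I : RGDInputsAt F ι₁ Jstar K₀ S hU7ₛ hJ hJu Fi Kc G 𝓜 w hw h𝓨 θ e) [ExpChar (geomResidueField w) I.pChar]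
    (𝔡 : ∀ xbar, DockAt I xbar)
    (quotΩ : ∀ y, LineOf I y → AlgPoints (S.M.obj Kc) (AlgebraicClosure (w.adicCompletion F)))
    (translΩ : AlgPoints (S.M.obj Kc) (AlgebraicClosure (w.adicCompletion F)) → AlgPoints (S.M.obj Kc) (AlgebraicClosure (w.adicCompletion F)))
    (_hhecke : HeckeClause I quotΩ translΩ) (_hroof : RoofLink I quotΩ) (_hroof₂ : RoofLink₂ I translΩ)
    (_hunit : (UnitaryGroup.isUnit_placeForm Jstar hJu w).unit ∈ glInt 2 (w.adicCompletion F))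
    (_hKc : UnitaryGroup.IsHyperspecialAt ↥(maximalRealSubfield F) F (IsCMField.complexConj F) 2 Jstar Kc.1.1
      (w.under (𝓞 ↥(maximalRealSubfield F)))) :
    ∃ (sp : ∀ y, LineOf I y → SubOf I 𝔡 (red₀Of S Kc 𝓜 w h𝓨 e y))
      (quot : ∀ xbar, SubOf I 𝔡 xbar → AlgPoints (𝓜.localise w).reductionAt (geomResidueField w))
      (transl : AlgPoints (𝓜.localise w).reductionAt (geomResidueField w) → AlgPoints (𝓜.localise w).reductionAt (geomResidueField w))
      (isogW₀ : ∀ xbar (H : SubOf I 𝔡 xbar), (𝔡 xbar).G₀ ⟶ (𝔡 (quot xbar H)).G₀),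
      RedQuotLaw I 𝔡 quotΩ sp quot ∧ RedTranslLaw S Kc 𝓜 w h𝓨 e translΩ transl ∧ CanonicalLineLaw I 𝔡 sp ∧ SpSurjLaw I 𝔡 sp ∧
      IsogHomLaw I 𝔡 quot isogW₀ ∧ IsogKerLaw I 𝔡 quot isogW₀ ∧ QuotQuot₀Law I 𝔡 quot transl isogW₀ := by
  -- ED. 4: PAID over the organ heads (§Σ `stub_SPEC_of_heads`; the one head not yet served enters as the NAMED socket `stub_RHO1` of §Σ′; [WQ] is the served §Q head BY NAME)  [K6 ★ reserve v3, «M-142g» (A): the (ρ1𝒞) head enters BY ITS ★ TERM `…F0P6aLineSpecialisation.exists_quotLegReduction I` — the by-term alias `stub_RHO1` is not re-homed]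
  haveI := I.comm
  exact stub_SPEC_of_heads I 𝔡 quotΩ translΩ _hhecke _hroof _hroof₂ _hunit _hKc (Summit.HodgeConjecture.HodgeConjecture.Cruxes.HLiu418.F0P6aLineSpecialisation.exists_quotLegReduction I) (hrkG_of_dock I) (exists_isogW₀_of_quotLeg I)
    (mono_coverPin₀ I) (le_ker_isogW₀_of_himg I) (red₀Of_quotΩ_eq_of_quotLegReduction₀ I) (red₀Of_translΩ_eq_of_red₀Of_eq I) (red₀Of_quotΩ_eq_red₀Of_translΩ_of_le_ker_layer I)

set_option maxHeartbeats 400000 in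
omit [FiniteDimensional F Fi] [Finite G] in
/-- **`stub_SHEETS` — EVERY SPECIAL POINT IS A `θ(τ,1)_s`-TRANSLATE OF AN `e`-SHEET REDUCTION** (θ-geometry road, light half): every `κ̄(w)`-point of `𝓨_s` lifts to an `Ω`-point of
the thickened generic fibre (★ `geomReductionMap_surjective_of_isSmoothProper`), every such point is `ℓ_{e′} y` on a sheet `e′ = e ∘ γ` (`Fᵢ∕F` Galois), and `red (ℓ_{e∘γ} y) =
θ(γ^{±1},1)_s (red (ℓ_e y))` by `_hθ` (generic `θ(γ,1)` = deck action) + ★ `GaloisThickeningFrobeniusSheetwise.geomReductionMap_thickeningLift_comp_symm`.  Why it might fail: it does not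
(orientation of `γ` is absorbed by the group). [cite: SerreTate1968, §1 Lemma 2] [cite: GortzWedhorn2020, (14.20)] -/
theorem stub_SHEETS
    (_hθ : ∀ γ : Fi ≃ₐ[F] Fi,
       (genericFibre (HeightOneSpectrum.valuationSubringAtPrime F w) F).map
             (Over.isoMk (θ.aut (γ, 1)) (θ.aut_comp (γ, 1))).hom ≫ (𝓜.localise w).genericIso'.hom
         = (𝓜.localise w).genericIso'.hom ≫
             (Over.isoMk ((thickeningGalAction (L := Fi) (S.M.obj Kc)).aut γ)
               ((thickeningGalAction (L := Fi) (S.M.obj Kc)).aut_comp γ)).hom) :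
    SheetDecompLaw S Kc 𝓜 w h𝓨 θ e := by
  -- (ℓ1) = ★ SHEET-COVER `IntegralModel.exists_aut_geomReductionMap_thickeningLift_eq_of_isSmoothProper` BY NAME (`Normal F Fi` from the frame՚s `[IsGalois F Fi]`;
  -- `actOf`∕`red₀Of` unfold to its right-hand side); LA2-p03 (g0) payment of organ (O2), 2026-09-02.
  intro xbar
  obtain ⟨τ, y, h⟩ :=
    Literature.AlgebraicGeometry.Motives.IntegralModel.exists_aut_geomReductionMap_thickeningLift_eq_of_isSmoothProper
      (S.M.obj Kc) (𝓜.localise w) h𝓨 θ _hθ e xbar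
  exact ⟨τ, y, h.symm⟩

set_option linter.unusedSectionVars false in
set_option maxHeartbeats 400000 in
/-- **`stub_LAYERISO` — THE `c•w`-LAYERS OF THE DOCKS AT `x̄` AND AT `θ(τ,1)_s x̄` ARE ISOMORPHIC, EQUIVARIANTLY** (θ-geometry road, heavy half).  The iso is EXISTENTIAL
(`RGDInputsAt` ED. 3 carries no `θ`-structure on `univ`, LA2-p03 (θ-!)); it is TRUE in every model of the letters and the supplier is the **RETURN-ISOGENY ROUTE** (junk-robust;
the naive «reduce the cover when `𝔞_τ ⊥ c•w`» is NOT available — coprimality is no ED. 3 law, LA2-p03 02:11:43Z rescaling witness `𝔞′ = p𝔞`, `c′ = c ≫ ι(p)` — and no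
classification of `G₀` from the dock rows exists, ibid. (b)): write `x̄ = θ(σ,1)_s (red₀ y)` (`stub_SHEETS`), so both points are sheet readings `red (ℓ_{e₁} y)`, `red (ℓ_{e₂} y)`
(★ `geomReductionMap_thickeningLift_comp_symm`, ★ `map_specialFibre_aut_mul`); (L5) `I.coverΩ e₁ γ y` gives `c : A_{e₁,y} → A_{e₂,y}` with (t1) `c ≫ d_a = ι(a)`, `d_a ≫ c = ι(a)`
for EVERY `a ∈ 𝔞_γ`, (t2) the `𝔞̄`-bound and (t4); with `twistNorm_spec` `(n) = 𝔞𝔞̄` the Tate sandwich `𝔞T′ ⊆ c(T)`, `𝔞̄c(T) ⊆ nT′` forces `c(T) = 𝔞T′`, i.e. `Ker c = A[𝔞_γ]`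
EXACTLY (★ `SerreTensorRecognitionOfPoints` currency); pick `a ∈ 𝔞_γ` of EXACT `c•w`-valuation `k = v_{c•w}(𝔞_γ)` (`twistIdeal_ne_bot` + CRT): then `Ker d_a` has trivial
`c•w`-part (`d_a ∘ c = [a]` and both kill `A[𝔭_{c•w}^k]` on the `c•w`-divisible group), so `[b] = g ∘ d_a` upstairs for some `b ∉ 𝔭_{c•w}` (★ KER-EQ descent); reduce `d_a`, `g`
and the identity on ONE (ν7) stage (★ `exists_stage_hom_reduction_turnkey`, uniqueness `pullback_map_injective_of_flat`; (ν8) (ii) for `ι`): downstairs `d̄_a ≫ ḡ = ι_s(b)` is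
invertible on the `c•w`-layer, so `d̄_a` restricted through `hkerG₀`∕`hι₀G` is an equivariant MONO `G₀(θx̄) → G₀(x̄)` between finite group schemes of equal rank `q²` (`hrkG₀`),
hence an iso (★ `KernelRecognitionByRank` ∕ `IdealKernelLayerMap.isIso_of_comp_eq`); `β₀`-equivariance from (t4) by (ν8) (ii) and `hβ₀G`.  Why it might fail: it does not
mathematically; Lean risks = the common-stage composite transfer and the `𝒪_F ⊗ ℤ_p`-lattice sandwich (size L).  A (TW) law «`θ(τ,1)^*univ ≅ univ ⊗ 𝔞_τ`» in a later
spine edition would shortcut it to ★ `AbelianSchemeTwistedFibreTransport` (desk option, not assumed here).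
[cite: Shimura1998, §13.1, Theorem 1; §18.6] [cite: SerreTate1968, §1 Lemma 2, Theorem 1] [cite: RapoportSmithlingZhang2020Diagonal, Lemma 3.4–Prop. 3.7, pp. 12–14] [cite: Tate1997FiniteFlatGroupSchemes, (3.7)] -/
theorem stub_LAYERISO (I : RGDInputsAt F ι₁ Jstar K₀ S hU7ₛ hJ hJu Fi Kc G 𝓜 w hw h𝓨 θ e) [ExpChar (geomResidueField w) I.pChar]
    (𝔡 : ∀ xbar, DockAt I xbar)
    (_hθ : ∀ γ : Fi ≃ₐ[F] Fi,
       (genericFibre (HeightOneSpectrum.valuationSubringAtPrime F w) F).map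
             (Over.isoMk (θ.aut (γ, 1)) (θ.aut_comp (γ, 1))).hom ≫ (𝓜.localise w).genericIso'.hom
         = (𝓜.localise w).genericIso'.hom ≫
             (Over.isoMk ((thickeningGalAction (L := Fi) (S.M.obj Kc)).aut γ)
               ((thickeningGalAction (L := Fi) (S.M.obj Kc)).aut_comp γ)).hom) :
    LayerIsoLaw I 𝔡 :=
  -- [ED. 4″ + LAYERISO PINS, LA2-p03 (g4) 2026-09-02 — SAME statement, SAME road, proof-body only; 393 s → ≈ 18 s of check wall (L2 bus 16:45:31Z):
  --  (P1) the fibre-commutativity family `hc` built ONCE with ★ `isCommMonObj_baseChange`՚s implicit base scheme PINNED to `pullback (𝓜.localise w).total.hom (specResidueField w)`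
  --       (left implicit it is read off `xbar.left` as `(𝓜.localise w).reductionAt.left` — definitionally, not syntactically, equal — and each `IsCommMonObj` unification then
  --       walks `Over.cartesianMonoidalCategory` down to pullback cones, 6–24 s apiece); (P2) `(Afib := …) (actfib := …)` NAMED at both §C∕§D applications; (P3) `hc` BY NAME.]
  haveI hc : ∀ xbar : AlgPoints (𝓜.localise w).reductionAt (geomResidueField w),
      IsCommMonObj ((I.univ.baseChange (pullback.fst (𝓜.localise w).total.hom (specResidueField w))).baseChange xbar.left).X :=
    fun xbar => @Literature.AlgebraicGeometry.AbelianSchemes.AbelianSchemeOver.isCommMonObj_baseChange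
      (pullback (𝓜.localise w).total.hom (specResidueField w)) _ xbar.left
      (I.univ.baseChange (pullback.fst (𝓜.localise w).total.hom (specResidueField w)))
      (@Literature.AlgebraicGeometry.AbelianSchemes.AbelianSchemeOver.isCommMonObj_baseChange _ _
        (pullback.fst (𝓜.localise w).total.hom (specResidueField w)) I.univ I.comm)
  layerIsoLaw_of_sheet I 𝔡 (stub_SHEETS (h𝓨 := h𝓨) (e := e) _hθ) (fun γ₁ γ₂ p => actOf_mul γ₁ γ₂ p)
    (layerIso_on_sheet_of_fibreRecognition I (Afib := (fun xbar => (I.univ.baseChange (pullback.fst (𝓜.localise w).total.hom (specResidueField w))).baseChange xbar.left)) (actfib := (fun xbar => (I.act.baseChange (pullback.fst (𝓜.localise w).total.hom (specResidueField w))).baseChange xbar.left)) 𝔡 hc _hθ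
      (hrec_of_inputs I (Afib := (fun xbar => (I.univ.baseChange (pullback.fst (𝓜.localise w).total.hom (specResidueField w))).baseChange xbar.left)) (actfib := (fun xbar => (I.act.baseChange (pullback.fst (𝓜.localise w).total.hom (specResidueField w))).baseChange xbar.left)) (fun _ => rfl) (fun _ => HEq.rfl) hc))

end Stubs

/-! ## §1.3′ helpers for stub_TRANSPORT (payer LA2-p01 (g0)) — TRANSPORT MACHINERY: `actOf` is an action, sheet coordinates, canonical admissible transport, the transported readings -/

section Machinery

open scoped MonObj Obj

-- the frame of the tree՚s `Letters` section (no Galois instances needed for the machinery)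
variable {F : Type} [Field F] [NumberField F] [IsCMField F] {ι₁ : F →+* ℂ}
    {Jstar : Matrix (Fin 2) (Fin 2) F}
    {K₀ : C5.OpenCompactSubgroup ↥(finAdelic ↥(maximalRealSubfield F) F (IsCMField.complexConj F) 2 Jstar)}
    {S : RecordSystemGS F Jstar ι₁ K₀} {hU7ₛ : S.HeckeTranslateDefinedOver}
    {hJ : (Jstar.map (IsCMField.complexConj F))ᵀ = Jstar} {hJu : IsUnit Jstar}
    {Fi : Type} [Field Fi] [Algebra F Fi] {Kc : C5.SmallLevel K₀} {G : Type} [Group G]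
    {𝓜 : IntegralModel (𝓞 F) F ((thickening F Fi).obj (S.M.obj Kc))}
    {w : HeightOneSpectrum (𝓞 F)} {hw : (IsCMField.complexConj F) • w ≠ w} {h𝓨 : (𝓜.localise w).IsSmoothProper 1}
    {θ : ActionOver (𝓜.localise w).total.hom ((Fi ≃ₐ[F] Fi) × G)}
    {e : Fi →ₐ[F] AlgebraicClosure (w.adicCompletion F)}

/-! #### §A `actOf` is a left action of `Fi ≃ₐ[F] Fi` on the special points (`aut_mul_hom` ∕ `isoMk_aut_mul_hom` ∕ `actOf_mul` are the leaf՚s ED. 2 §A, used BY NAME) -/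

set_option maxHeartbeats 400000 in
/-- `θ.aut (1, 1)` is the identity. [cite: GortzWedhorn2020, (14.20)] -/
theorem aut_one_hom : (θ.aut ((1 : Fi ≃ₐ[F] Fi), (1 : G))).hom = 𝟙 _ := by
  have h : (((1 : Fi ≃ₐ[F] Fi), (1 : G)) : (Fi ≃ₐ[F] Fi) × G) = 1 := rfl
  rw [h, map_one]
  rfl

set_option maxHeartbeats 400000 in
/-- `θ(1, 1)` is the identity of the localised model over its base. [cite: GortzWedhorn2020, (14.20)] -/
theorem isoMk_aut_one_hom : (Over.isoMk (θ.aut ((1 : Fi ≃ₐ[F] Fi), (1 : G))) (θ.aut_comp (1, 1))).hom = 𝟙 _ :=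
  Over.OverMorphism.ext aut_one_hom

set_option maxHeartbeats 400000 in
/-- **`actOf 1 = id`.** [cite: GortzWedhorn2020, (14.20)] -/
theorem actOf_one (p : AlgPoints (𝓜.localise w).reductionAt (geomResidueField w)) : actOf S Kc 𝓜 w θ 1 p = p := by
  have h1 : (specialFibreFunctor w).map (Over.isoMk (θ.aut ((1 : Fi ≃ₐ[F] Fi), (1 : G))) (θ.aut_comp (1, 1))).hom = 𝟙 _ := by
    rw [isoMk_aut_one_hom, CategoryTheory.Functor.map_id]
  exact (congrArg (fun f => p ≫ f) h1).trans (Category.comp_id _)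

set_option maxHeartbeats 400000 in
/-- `actOf τ⁻¹ (actOf τ p) = p`. [cite: GortzWedhorn2020, (14.20)] -/
theorem actOf_inv_actOf (τ : Fi ≃ₐ[F] Fi) (p : AlgPoints (𝓜.localise w).reductionAt (geomResidueField w)) :
    actOf S Kc 𝓜 w θ τ⁻¹ (actOf S Kc 𝓜 w θ τ p) = p := by
  rw [← actOf_mul, inv_mul_cancel, actOf_one]

set_option maxHeartbeats 400000 in
/-- `actOf τ (actOf τ⁻¹ p) = p`. [cite: GortzWedhorn2020, (14.20)] -/
theorem actOf_actOf_inv (τ : Fi ≃ₐ[F] Fi) (p : AlgPoints (𝓜.localise w).reductionAt (geomResidueField w)) :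
    actOf S Kc 𝓜 w θ τ (actOf S Kc 𝓜 w θ τ⁻¹ p) = p := by
  rw [← actOf_mul, mul_inv_cancel, actOf_one]

/-! #### §B The sheet-disjointness guard, sheet coordinates `τOf ∕ yOf ∕ base` and their UNIQUENESS -/

variable (S) (Kc) (𝓜) (w) (h𝓨) (θ) (e) in
set_option maxHeartbeats 400000 in
/-- **`SheetDisjoint` — the socket՚s frame guard `_hdisj`** («special sheets are disjoint»: if `red₀ P = θ(β,1)_s (red₀ Q)` then `β = 1`), named so that the
machinery can quote it; its text is the `_hdisj` binder of `stub_DOWN` VERBATIM (so `_hdisj` IS a proof of it).  A definition. (print: SerreTate1968, §1 Lemma 2) -/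
def SheetDisjoint : Prop :=
  haveI : AlgebraicGeometry.IsProper (𝓜.localise w).total.hom := h𝓨.2
  ∀ (β : Fi ≃ₐ[F] Fi) (P Q : AlgPoints (S.M.obj Kc) (AlgebraicClosure (w.adicCompletion F))),
    (𝓜.localise w).geomReductionMap (thickeningLift e (S.M.obj Kc) P) =
      AlgPoints.map ((specialFibreFunctor w).map (Over.isoMk (θ.aut (β, 1)) (θ.aut_comp (β, 1))).hom :
          (𝓜.localise w).reductionAt ⟶ (𝓜.localise w).reductionAt)
        ((𝓜.localise w).geomReductionMap (thickeningLift e (S.M.obj Kc) Q)) → β = 1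

set_option maxHeartbeats 400000 in
/-- **UNIQUENESS OF THE SHEET INDEX**: `actOf α (red₀ y) = actOf β (red₀ y′)` forces `α = β` (apply `actOf β⁻¹` and `SheetDisjoint`). [cite: SerreTate1968, §1 Lemma 2] -/
theorem eq_of_actOf_red₀Of_eq (hdisj : SheetDisjoint S Kc 𝓜 w h𝓨 θ e) {α β : Fi ≃ₐ[F] Fi}
    {y y' : AlgPoints (S.M.obj Kc) (AlgebraicClosure (w.adicCompletion F))}
    (h : actOf S Kc 𝓜 w θ α (red₀Of S Kc 𝓜 w h𝓨 e y) = actOf S Kc 𝓜 w θ β (red₀Of S Kc 𝓜 w h𝓨 e y')) : α = β := by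
  have h2 : red₀Of S Kc 𝓜 w h𝓨 e y' = actOf S Kc 𝓜 w θ (β⁻¹ * α) (red₀Of S Kc 𝓜 w h𝓨 e y) := by
    rw [actOf_mul, h, actOf_inv_actOf]
  have h3 : β⁻¹ * α = 1 := hdisj (β⁻¹ * α) y' y h2
  rw [inv_mul_eq_one] at h3
  exact h3.symm

variable (hsheets : SheetDecompLaw S Kc 𝓜 w h𝓨 θ e)

set_option maxHeartbeats 400000 in
/-- The SHEET INDEX of a special point (choice from `SheetDecompLaw`). [cite: SerreTate1968, §1 Lemma 2] -/
def τOf (xbar : AlgPoints (𝓜.localise w).reductionAt (geomResidueField w)) : Fi ≃ₐ[F] Fi :=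
  (hsheets xbar).choose

set_option maxHeartbeats 400000 in
/-- An `e`-SHEET LIFT of a special point (choice from `SheetDecompLaw`). [cite: SerreTate1968, §1 Lemma 2] -/
def yOf (xbar : AlgPoints (𝓜.localise w).reductionAt (geomResidueField w)) :
    AlgPoints (S.M.obj Kc) (AlgebraicClosure (w.adicCompletion F)) :=
  (hsheets xbar).choose_spec.choose

set_option maxHeartbeats 400000 in
/-- The decomposition `x̄ = actOf (τOf x̄) (red₀ (yOf x̄))`. [cite: SerreTate1968, §1 Lemma 2] -/
theorem actOf_τOf_red₀Of_yOf (xbar : AlgPoints (𝓜.localise w).reductionAt (geomResidueField w)) :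
    actOf S Kc 𝓜 w θ (τOf hsheets xbar) (red₀Of S Kc 𝓜 w h𝓨 e (yOf hsheets xbar)) = xbar :=
  (hsheets xbar).choose_spec.choose_spec

set_option maxHeartbeats 400000 in
/-- The `e`-SHEET REPRESENTATIVE `base x̄ := actOf (τOf x̄)⁻¹ x̄` of a special point.  An abbreviation. [cite: SerreTate1968, §1 Lemma 2] -/
abbrev base (xbar : AlgPoints (𝓜.localise w).reductionAt (geomResidueField w)) :
    AlgPoints (𝓜.localise w).reductionAt (geomResidueField w) :=
  actOf S Kc 𝓜 w θ (τOf hsheets xbar)⁻¹ xbar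

set_option maxHeartbeats 400000 in
/-- `base x̄ = red₀ (yOf x̄)` — the representative IS on the `e`-sheet. [cite: SerreTate1968, §1 Lemma 2] -/
theorem base_eq_red₀Of_yOf (xbar : AlgPoints (𝓜.localise w).reductionAt (geomResidueField w)) :
    base hsheets xbar = red₀Of S Kc 𝓜 w h𝓨 e (yOf hsheets xbar) := by
  have h := actOf_τOf_red₀Of_yOf hsheets xbar
  calc base hsheets xbar
      = actOf S Kc 𝓜 w θ (τOf hsheets xbar)⁻¹ (actOf S Kc 𝓜 w θ (τOf hsheets xbar) (red₀Of S Kc 𝓜 w h𝓨 e (yOf hsheets xbar))) := by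
          rw [h]
    _ = red₀Of S Kc 𝓜 w h𝓨 e (yOf hsheets xbar) := actOf_inv_actOf _ _

set_option maxHeartbeats 400000 in
/-- `actOf (τOf x̄) (base x̄) = x̄`. [cite: SerreTate1968, §1 Lemma 2] -/
theorem actOf_τOf_base (xbar : AlgPoints (𝓜.localise w).reductionAt (geomResidueField w)) :
    actOf S Kc 𝓜 w θ (τOf hsheets xbar) (base hsheets xbar) = xbar :=
  actOf_actOf_inv _ _

set_option maxHeartbeats 400000 in
/-- **UNIQUENESS: `τOf (actOf σ x̄) = σ * τOf x̄`.** [cite: SerreTate1968, §1 Lemma 2] -/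
theorem τOf_actOf (hdisj : SheetDisjoint S Kc 𝓜 w h𝓨 θ e) (σ : Fi ≃ₐ[F] Fi)
    (xbar : AlgPoints (𝓜.localise w).reductionAt (geomResidueField w)) :
    τOf hsheets (actOf S Kc 𝓜 w θ σ xbar) = σ * τOf hsheets xbar := by
  apply eq_of_actOf_red₀Of_eq hdisj (y := yOf hsheets (actOf S Kc 𝓜 w θ σ xbar)) (y' := yOf hsheets xbar)
  rw [actOf_τOf_red₀Of_yOf, actOf_mul, actOf_τOf_red₀Of_yOf]

set_option maxHeartbeats 400000 in
/-- **UNIQUENESS ON THE SHEET: `τOf (red₀ y) = 1`.** [cite: SerreTate1968, §1 Lemma 2] -/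
theorem τOf_red₀Of (hdisj : SheetDisjoint S Kc 𝓜 w h𝓨 θ e) (y : AlgPoints (S.M.obj Kc) (AlgebraicClosure (w.adicCompletion F))) :
    τOf hsheets (red₀Of S Kc 𝓜 w h𝓨 e y) = 1 := by
  apply eq_of_actOf_red₀Of_eq hdisj (y := yOf hsheets (red₀Of S Kc 𝓜 w h𝓨 e y)) (y' := y)
  rw [actOf_τOf_red₀Of_yOf, actOf_one]

set_option maxHeartbeats 400000 in
/-- **UNIQUENESS: `base (actOf σ x̄) = base x̄`.** [cite: SerreTate1968, §1 Lemma 2] -/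
theorem base_actOf (hdisj : SheetDisjoint S Kc 𝓜 w h𝓨 θ e) (σ : Fi ≃ₐ[F] Fi)
    (xbar : AlgPoints (𝓜.localise w).reductionAt (geomResidueField w)) :
    base hsheets (actOf S Kc 𝓜 w θ σ xbar) = base hsheets xbar := by
  show actOf S Kc 𝓜 w θ (τOf hsheets (actOf S Kc 𝓜 w θ σ xbar))⁻¹ (actOf S Kc 𝓜 w θ σ xbar) =
    actOf S Kc 𝓜 w θ (τOf hsheets xbar)⁻¹ xbar
  rw [τOf_actOf hsheets hdisj, mul_inv_rev, actOf_mul, actOf_inv_actOf]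

end Machinery
end Summit.HodgeConjecture.HodgeConjecture.Cruxes.HLiu418.F0P6aStubDOWN
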